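import Summits.ValiantsHypothesis.ValiantsHypothesis.Theses.ElementaryWordLength
import Summits.ValiantsHypothesis.ValiantsHypothesis.Theorems.ElementaryWordLengthWordPerCubicStubSegmentSubalgebra
import Summits.ValiantsHypothesis.ValiantsHypothesis.Theorems.ElementaryWordLengthWordPerCubicStubCardLeOfAlgebraicIndependent
import Summits.ValiantsHypothesis.ValiantsHypothesis.Theorems.ElementaryWordLengthWordPerCubicStubPerPairCoeff
import Summits.ValiantsHypothesis.ValiantsHypothesis.Theorems.ElementaryWordLengthWordPerCubicStubPairAlgIndependent
import Summits.ValiantsHypothesis.ValiantsHypothesis.Theorems.ElementaryWordLengthWordPerCubicStubBlockSum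
import Summits.ValiantsHypothesis.ValiantsHypothesis.Theorems.ElementaryWordLengthWordPerCubicStubCubicArithmetic

/-!
# Route `ElementaryWordLength`, crux `WordPerCubic` (stmt-ValiantsHypothesis-6625): a cubic lower bound for
# the affine elementary word length of `E_02(per_n)` — Kalorkoti's count in the word model

**Theorem** (`wordPerCubic_proof`, the crux by name, with `c = 1/36`, `n₀ = 8`): for every `n ≥ 8`, every
product of elementary letters `E_ij(λ)`, `E_ij(λ·x_rc)` in `E_3(ℂ[x_11..x_nn])` that equals
`E_02(per_n) = 1 + per_n · e_02` has at least `n³/36` letters.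

Proof (line `Sketch`, idea `segment-jacobian`; Kalorkoti 1985's transcendence-degree method for formula size,
re-run natively on transvection words).  Fix the shifted transversal `B_k = {(c+k, c)}` and split variables by
`φ_k = aeval (v ↦ if v ∈ B_k then X v else C (X v))`.  (S1, `stub_segmentSubalgebra`) a word with `ℓ_k`
letters in `B_k` factors as `M₀ E₁ M₁ ⋯ E_ℓ M_ℓ` with `B_k`-free segments `M_t`, so every `B_k`-coefficient
of every entry of the product lies in the subalgebra generated by the `≤ 9(ℓ_k+1)` segment entries;
(S3, `stub_perPairCoeff`) the coefficient of `∏_{c∉{a,b}} X(c+k,c)` in `per_n` is `X(b+k,a)·X(a+k,b)`;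
(S4, `stub_pairAlgIndependent`) over `a < b` these are algebraically independent; (S2,
`stub_card_le_of_algebraicIndependent`) hence `n(n-1)/2 ≤ 9(ℓ_k+1)`; (S5, `stub_blockSum`) `Σ_k ℓ_k ≤ |w|`;
(S6, `stub_cubicArithmetic`) `|w| ≥ n³/36` for `n ≥ 8`.  References: Kalorkoti 1985 (SIAM J. Comput. 14),
Bürgisser–Clausen–Shokrollahi 1997 (Ch. 5, p. 607 notes), Ben-Or–Cleve 1992 (the word model).
-/

noncomputable section

-- `Summit.ValiantsHypothesis.ValiantsHypothesis.…` is the tree's mandated single-conjunct layout.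
set_option linter.dupNamespace false

namespace Summit.ValiantsHypothesis.ValiantsHypothesis.Theorems.ElementaryWordLengthWordPerCubic

open Literature.Computability.AlgebraicComplexity MvPolynomial

/-- The `(0,2)` entry of a mapped transvection `E_02(f)` is the image of `f`. [folklore] -/
theorem map_transvection_apply_02 {R S : Type} [CommRing R] [CommRing S] (f : R → S) (x : R) :
    ((Matrix.transvection (0 : Fin 3) 2 x).map f) 0 2 = f x := by
  simp [Matrix.transvection, Matrix.map_apply, Matrix.add_apply, Matrix.single]

/-- **Per-block count**: for every shift `k`, the number `ℓ_k` of letters of a word for `E_02(per_n)` carrying a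
variable of the transversal `B_k = {(c+k, c)}` satisfies `n(n-1)/2 ≤ 9(ℓ_k + 1)`. [folklore] -/
theorem card_pairs_le_blockLetters (n : ℕ) (w : List (Fin 3 × Fin 3 × ℂ × Option (Fin n × Fin n)))
    (hprod : (w.map (fun l => Matrix.transvection l.1 l.2.1
      (MvPolynomial.C l.2.2.1 * l.2.2.2.elim 1 MvPolynomial.X))).prod =
      Matrix.transvection (0 : Fin 3) 2 (perPoly (Fin n) ℂ)) (k : Fin n) :
    Fintype.card {e : Fin n × Fin n // e.1 < e.2} ≤
      9 * (w.countP (fun l => l.2.2.2.any (fun v => decide (v.1 = v.2 + k))) + 1) := by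
  obtain ⟨s, hs, hcoef⟩ := stub_segmentSubalgebra (fun v : Fin n × Fin n => v.1 = v.2 + k) w
  refine le_trans (stub_card_le_of_algebraicIndependent s _ (stub_pairAlgIndependent n k) ?_) hs
  intro e
  have h02 := hcoef 0 2 (∑ c ∈ ({e.1.1, e.1.2} : Finset (Fin n))ᶜ, Finsupp.single (c + k, c) 1)
  rw [hprod, map_transvection_apply_02, stub_perPairCoeff n k e.1.1 e.1.2 (ne_of_lt e.2)] at h02
  exact h02

/-- **The crux `ElementaryWordLength.WordPerCubic`** (stmt-ValiantsHypothesis-6625), by name, with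
`c = 1/36`, `n₀ = 8`: every affine elementary word for `E_02(per_n)`, `n ≥ 8`, has length `≥ n³/36`
(Kalorkoti's transcendence count in the word model). [folklore] -/
theorem wordPerCubic_proof :
    Summit.ValiantsHypothesis.ValiantsHypothesis.Theses.ElementaryWordLength.WordPerCubic := by
  refine ⟨1 / 36, by norm_num, 8, fun n hn L hex => ?_⟩
  obtain ⟨w, hlen, _hw, hprod⟩ := hex
  exact stub_cubicArithmetic n hn L _ (card_pairs_le_blockLetters n w hprod)
    (le_trans (stub_blockSum n w) hlen)

end Summit.ValiantsHypothesis.ValiantsHypothesis.Theorems.ElementaryWordLengthWordPerCubic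

end
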